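/-
Copyright (c) 2026 the pub-hodgecm-mathlib formalisation cell (harness21).  Prover seat hodgecm-mathlib-K2Liu-p09 (g2): Track B «K2-LIT», #184♮ = hLiu418,
payer-internal step (br)-analytic half of file #34 `Theorems/K2LiuDoublingZetaGL1.lean` (LEAD F0P6-plan (g10) DEAL K2/STATUS 2026-09-04T02:36:29Z;
DEPMAP v2.5 §10 TABLE A row «docking» (br), TABLE B row «the identity»: ★ #28s's operator identity → ★ #29s's scalar hypothesis (E)).
-/
import Literature.NumberTheory.K2Lit.DoublingZetaIntegral
import Literature.NumberTheory.K2Lit.LocalDoublingZeta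
import Literature.NumberTheory.Automorphic.AutomorphicSpectrum
import Summits.HodgeConjecture.HodgeConjecture.Theorems.K2LiuDoublingZetaGL1Prelim
import HarnessLib

/-!
# Crux `HLiu418`, Track B road `K2_Liu`, file #34 — (br), analytic half: OPERATOR EIGEN-IDENTITY ⇒ SCALAR (E) FOR THE MATRIX COEFFICIENT

Cell `hodgecm-mathlib`, crux item hLiu418 = `stmt-HodgeConjecture-24832`, route of record `HCCMUnconditional`; squad K2 ∕ K2Liu, LEAD F0P6-plan (g10),
prover K2Liu-p09 (g2).  THEOREMS ONLY (no `def`, no instance, no notation, no named-fact hypothesis, no `sorry`, default heartbeats); lane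
`--supports stmt-HodgeConjecture-24832 --as helper` (count-neutral).  GENERIC (`AdelicGroupData`, any local group `Gv` with a homomorphism
`incl : Gv →* G(𝔸)`), so that the CM payer only instantiates it at `incl := inclPlaceAdelic … v`.

★ #28s `K2LiuUnramifiedDoublingHeckeIdentity` concludes an OPERATOR identity `∫ Λ(g) • τ(g) u dν = c • u` (★ `K2Lit.IsDoublingHeckeEigenvector`) in a
Banach representation; ★ #29s `K2LiuDoublingPartialEuler` consumes, at every `v ∉ S`, the SCALAR identities
(E) `localZeta ν Λ (g ↦ ⟨π(t · incl g)φ₁, φ₂⟩) = c · ⟨π(t)φ₁, φ₂⟩` for ALL translates `t ∈ G(𝔸)`.  With `τ g := W.toContRep (incl g)` on a closed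
`G(𝔸)`-stable subspace `W ⊆ L²([G], μ)` (★ `DiscreteAutomorphicRep.space`), `u := w ∈ W` with `w =ᵐ φ₁`, and `φ₂ ∈ L²`, the bridge is the
continuous linear functional `ℓ_t(v) = ⟪φ₂, R(t) v⟫_{L²}`: `⟨π(t · incl g)φ₁, φ₂⟩ = ℓ_t(τ(g) w)` (★ `K2LiuDoublingZetaGL1Prelim.quotMatrixCoeff_eq_integral_rightRegular`)
and ★ `K2Lit.localZeta_eq_of_isDoublingHeckeEigenvector` (Bochner integral commutes with `ℓ_t`).
* `quotMatrixCoeff_eq_inner_rightRegular` — `⟨π(g)φ₁, φ₂⟩ = ⟪φ₂ᴸ², R(g) w⟫` for `w =ᵐ φ₁`, `φ₂ᴸ² =ᵐ φ₂`;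
* `localScalar_of_isDoublingHeckeEigenvector` — **(E) from the operator identity**, all translates `t`.

HONEST LABEL: HC_CM is proved only modulo the printed citations (2 remaining named inputs: hLiu418 = stmt-HodgeConjecture-24832,
h413 = stmt-HodgeConjecture-24833) until rung 0 closes; this file is bookkeeping toward socket s23 and closes no item.
-/

set_option autoImplicit false
set_option linter.dupNamespace false

noncomputable section

open scoped ComplexConjugate InnerProductSpace
open NumberField MeasureTheory
open Literature.NumberTheory.Automorphic Literature.NumberTheory.K2Lit Literature.NumberTheory.K2Lit.SiegelDoubled

namespace Summit.HodgeConjecture.HodgeConjecture.Cruxes.HLiu418.K2LiuDoublingZetaGL1LocalScalar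

variable {K : Type} [Field K] [NumberField K] (𝒢 : AdelicGroupData.{0} K)
  (μ : Measure 𝒢.automorphicQuotient) [SMulInvariantMeasure 𝒢.Adelic 𝒢.automorphicQuotient μ]

/-- `⟨π(g)φ₁, φ₂⟩ = ⟪φ₂ᴸ², R(g) w⟫_{L²}` for `L²` classes `w =ᵐ φ₁`, `φ₂ᴸ² =ᵐ φ₂` (★ `quotMatrixCoeff_eq_integral_rightRegular` + Mathlib `L2.inner_def`:
`⟪f, g⟫ = ∫ conj(f) g`). [cite: Liu2021, §B.3 (B.7) p. 101] -/
theorem quotMatrixCoeff_eq_inner_rightRegular (w φ₂L : 𝒢.L2 μ) {φ₁ φ₂ : 𝒢.automorphicQuotient → ℂ}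
    (hw : ((w : 𝒢.L2 μ) : 𝒢.automorphicQuotient → ℂ) =ᵐ[μ] φ₁) (hφ₂ : ((φ₂L : 𝒢.L2 μ) : 𝒢.automorphicQuotient → ℂ) =ᵐ[μ] φ₂)
    (g : 𝒢.Adelic) :
    quotMatrixCoeff 𝒢 μ φ₁ φ₂ g = ⟪φ₂L, 𝒢.rightRegular μ g w⟫_ℂ := by
  rw [K2LiuDoublingZetaGL1Prelim.quotMatrixCoeff_eq_integral_rightRegular 𝒢 μ w hw φ₂ g, MeasureTheory.L2.inner_def]
  refine integral_congr_ae ?_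
  filter_upwards [hφ₂] with x hx
  rw [RCLike.inner_apply, ← hx, mul_comm]

/-- **(E) from the operator identity, all translates.**  Let `W ⊆ L²([G], μ)` be a closed `G(𝔸)`-stable subspace, `w ∈ W` with `w =ᵐ φ₁`, `φ₂ᴸ² =ᵐ φ₂`,
`incl : Gv →* G(𝔸)` a homomorphism from a local group, and suppose `w` is a doubling Hecke eigenvector of `(ν, Λ)` for `τ = W.toContRep ∘ incl` with
eigenvalue `c` (★ `IsDoublingHeckeEigenvector`).  Then for every `t ∈ G(𝔸)`:
`localZeta ν Λ (g ↦ ⟨π(t · incl g)φ₁, φ₂⟩) = c · ⟨π(t)φ₁, φ₂⟩` — hypothesis (E) of ★ #29s `doublingPartialEuler` at the place of `incl`.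
[cite: Li1992, §3 Thm. 3.1] [cite: Liu2011, §2C (2-4) p. 863] -/
theorem localScalar_of_isDoublingHeckeEigenvector (W : ContRepresentation.ClosedSubrep (𝒢.rightRegular μ)) (w : W.toSubmodule)
    (φ₂L : 𝒢.L2 μ) {φ₁ φ₂ : 𝒢.automorphicQuotient → ℂ}
    (hw : (((w : 𝒢.L2 μ)) : 𝒢.automorphicQuotient → ℂ) =ᵐ[μ] φ₁) (hφ₂ : ((φ₂L : 𝒢.L2 μ) : 𝒢.automorphicQuotient → ℂ) =ᵐ[μ] φ₂)
    {Gv : Type} [Group Gv] [MeasurableSpace Gv] (incl : Gv →* 𝒢.Adelic) (ν : Measure Gv) (Λ : Gv → ℂ) (c : ℂ)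
    (h : IsDoublingHeckeEigenvector ν Λ (fun g => W.toContRep (incl g)) w c) (t : 𝒢.Adelic) :
    localZeta ν Λ (fun g => quotMatrixCoeff 𝒢 μ φ₁ φ₂ (t * incl g)) = c * quotMatrixCoeff 𝒢 μ φ₁ φ₂ t := by
  haveI : CompleteSpace W.toSubmodule := W.isClosed'.completeSpace_coe
  -- the functional `ℓ_t(v) = ⟪φ₂ᴸ², R(t) v⟫`
  have key : ∀ v : W.toSubmodule,
      ((innerSL ℂ φ₂L).comp ((𝒢.rightRegular μ t).comp W.toSubmodule.subtypeL)) v = ⟪φ₂L, 𝒢.rightRegular μ t (v : 𝒢.L2 μ)⟫_ℂ := by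
    intro v
    rfl
  have h1 : ∀ g : Gv, quotMatrixCoeff 𝒢 μ φ₁ φ₂ (t * incl g) =
      ((innerSL ℂ φ₂L).comp ((𝒢.rightRegular μ t).comp W.toSubmodule.subtypeL)) (W.toContRep (incl g) w) := by
    intro g
    rw [key, ContRepresentation.ClosedSubrep.coe_toContRep_apply, quotMatrixCoeff_eq_inner_rightRegular 𝒢 μ (w : 𝒢.L2 μ) φ₂L hw hφ₂,
      map_mul]
    rfl
  have h2 : quotMatrixCoeff 𝒢 μ φ₁ φ₂ t = ((innerSL ℂ φ₂L).comp ((𝒢.rightRegular μ t).comp W.toSubmodule.subtypeL)) w := by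
    rw [key, quotMatrixCoeff_eq_inner_rightRegular 𝒢 μ (w : 𝒢.L2 μ) φ₂L hw hφ₂]
  simp_rw [h1, h2]
  exact localZeta_eq_of_isDoublingHeckeEigenvector ν Λ (fun g => W.toContRep (incl g)) h _

end Summit.HodgeConjecture.HodgeConjecture.Cruxes.HLiu418.K2LiuDoublingZetaGL1LocalScalar

end
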